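import Literature.Geometry.Lorentzian.IPlusRegular
import Literature.Geometry.Lorentzian.KillingOnIntegralCurveUnique
import Mathlib.Geometry.Manifold.Instances.Sphere
import Mathlib.Geometry.Manifold.ContMDiff.Atlas
import HarnessLib

/-!
# Crux `HawkingExtensionIsKerr` (stmt-FinalStateConjecture-17840), line `SketchIdeator2` —
# programme SEC, brick SEC-5e: the leaf charts of the `K`-foliation on `C` (lead c7)

Helper file of the line lead (c7) for programme SEC, registered sub-goal `stub_sec_leaf`.
Given a finite family of K-charts `(Wᵢ, Oᵢ, χᵢ, χiᵢ)` (`i : Fin N`) of a Killing field `K` on an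
open set `U` — straightening charts whose chart lines `σ ↦ χiᵢ (χᵢ x + σ • e₀)` are integral curves
of `K`, with the horizon `𝓔⁺` cut out by `χᵢ · 1 = 0` — with uniform `s`-room `2δ`, covering a
compact set `C ⊆ 𝓔⁺` homeomorphic to `S²` by the sets `Vᵢ := {x ∈ Wᵢ ∩ C | |χᵢ x 0| < δ/2}`, this
file puts the LEAF smooth structure on `C`: the maps `fᵢ := (χᵢ · 2, χᵢ · 3) : C → ℝ²` are
continuous on the open sets `Vᵢ`, injective there (hypothesis: two points of `Wᵢ ∩ C` on one chart
line coincide), hence open (hypothesis: invariance of domain on a sphere-like space), and their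
transition maps are smooth: for `x ∈ Vᵢ ∩ Vⱼ` the chart-`i` slice point `χiᵢ (χᵢ x - (χᵢ x 0) • e₀)`
lies in `Wⱼ` with `χⱼ`-image `χⱼ x - (χᵢ x 0) • e₀` (uniqueness of integral curves of the Killing
field inside `U`, `IsKillingFieldOn.eqOn_of_isMIntegralCurveOn`), so `fⱼ ∘ fᵢ⁻¹` is the smooth
holonomy `w ↦ P (χⱼ (χiᵢ (ι₀ w)))` (`ι₀ : ℝ² → ℝ⁴` the transversal embedding, `P : ℝ⁴ → ℝ²` the
projection to the coordinates `2, 3`).  The finite-atlas hypothesis then yields a `C^∞` structure on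
`C` in which every `fᵢ` is smooth on `Vᵢ` with a smooth local inverse, whence `dfᵢ` is injective.
-/

noncomputable section

set_option linter.dupNamespace false

namespace Summit.FinalStateConjecture.FinalStateConjecture.Theorems.HawkingExtensionIsKerr.SketchIdeator2

open Set Filter Bundle Function Literature.Geometry.Lorentzian
open scoped Manifold ContDiff Topology

/-- **The leaf charts of the `K`-foliation on `C` (registered sub-goal `stub_sec_leaf`).**  See the
module docstring: from a finite uniform family of K-charts covering the compact `C ⊆ 𝓔⁺` (`C ≃ₜ S²`),
the leaf coordinates `fᵢ = (χᵢ · 2, χᵢ · 3)` on `Vᵢ = {x ∈ Wᵢ ∩ C | |χᵢ x 0| < δ/2}` form a `C^∞`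
atlas of `C` (injectivity from the chart-line hypothesis, openness from invariance of domain, smooth
transitions from the uniqueness of `K`-integral curves inside `U`), in which every `fᵢ` is smooth on
`Vᵢ` with injective differential. -/
theorem stub_sec_leaf : ∀ (𝓑 : StationaryAFBlackHole.{0}) [𝓑.metric.HasLeviCivita] (U : Set 𝓑.carrier) (K : Π x : 𝓑.carrier, TangentSpace (𝓡 4) x), IsOpen U → 𝓑.metric.toPseudoRiemannianMetric.IsKillingFieldOn K U → ∀ (C : Set 𝓑.carrier), C ⊆ 𝓑.horizon → Nonempty (↥C ≃ₜ Metric.sphere (0 : E3) 1) → (∀ (W : Set 𝓑.carrier) (O : Set E4) (χ : 𝓑.carrier → E4) (χi : E4 → 𝓑.carrier), IsOpen W → IsOpen O → Convex ℝ O → W ⊆ U → (∀ x ∈ W, χ x ∈ O ∧ χi (χ x) = x) → (∀ y ∈ O, χi y ∈ W ∧ χ (χi y) = y) → (∀ x ∈ W, x ∈ 𝓑.horizon ↔ χ x 1 = 0) → (∀ x ∈ W, ∀ a b : ℝ, (∀ σ ∈ Ioo a b, χ x + σ • EuclideanSpace.single 0 1 ∈ O) → IsMIntegralCurveOn (fun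 σ : ℝ ↦ χi (χ x + σ • EuclideanSpace.single 0 1)) K (Ioo a b)) → ∀ x ∈ W ∩ C, ∀ x' ∈ W ∩ C, ∀ σ : ℝ, χ x' = χ x + σ • EuclideanSpace.single 0 1 → x' = x) → (∀ (V : Set ↥C) (g : ↥C → EuclideanSpace ℝ (Fin 2)), IsOpen V → ContinuousOn g V → InjOn g V → ∀ V' ⊆ V, IsOpen V' → IsOpen (g '' V')) → (∀ (X : Type) [TopologicalSpace X] [T2Space X] (N : ℕ) (V : Fin N → Set X) (f : Fin N → X → EuclideanSpace ℝ (Fin 2)) (fi : Fin N → EuclideanSpace ℝ (Fin 2) → X), (∀ i, IsOpen (V i)) → (∀ x, ∃ i, x ∈ V i) → (∀ i, ContinuousOn (f i) (V i)) → (∀ i, ∀ V' ⊆ V i, IsOpen V' → IsOpen (f i '' V')) → (∀ i, ∀ x ∈ V i, fi i (f i x) = x) → (∀ i j, ContDiffOn ℝ ∞ (f j ∘ fi i) (f i '' (V i ∩ V j))) → ∃ (_ : ChartedSpace (EuclideanSpace ℝ (Fin 2)) X) (_ : IsManifold (𝓡 2) ∞ X), (∀ i, ContMDiffOn (𝓡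 2) 𝓘(ℝ, EuclideanSpace ℝ (Fin 2)) ∞ (f i) (V i)) ∧ (∀ i, ContMDiffOn 𝓘(ℝ, EuclideanSpace ℝ (Fin 2)) (𝓡 2) ∞ (fi i) (f i '' V i))) → ∀ (N : ℕ) (δ : ℝ) (W : Fin N → Set 𝓑.carrier) (O : Fin N → Set E4) (χ : Fin N → 𝓑.carrier → E4) (χi : Fin N → E4 → 𝓑.carrier), 0 < δ → (∀ i, IsOpen (W i) ∧ IsOpen (O i) ∧ Convex ℝ (O i) ∧ W i ⊆ U ∧ (∀ x ∈ W i, χ i x ∈ O i ∧ χi i (χ i x) = x) ∧ (∀ y ∈ O i, χi i y ∈ W i ∧ χ i (χi i y) = y) ∧ ContMDiffOn (𝓡 4) 𝓘(ℝ, E4) ∞ (χ i) (W i) ∧ ContMDiffOn 𝓘(ℝ, E4) (𝓡 4) ∞ (χi i) (O i) ∧ (∀ x ∈ W i, mfderiv (𝓡 4) 𝓘(ℝ, E4) (χ i) x (K x) = EuclideanSpace.single 0 1) ∧ (∀ x ∈ W i, x ∈ 𝓑.horizon ↔ χ i x 1 = 0) ∧ (∀ x ∈ W i, ∀ a b : ℝ,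 (∀ σ ∈ Ioo a b, χ i x + σ • EuclideanSpace.single 0 1 ∈ O i) → IsMIntegralCurveOn (fun σ : ℝ ↦ χi i (χ i x + σ • EuclideanSpace.single 0 1)) K (Ioo a b))) → (∀ i, ∀ x ∈ W i, |χ i x 0| < δ → ∀ s : ℝ, |s| < 2 * δ → (χ i x - (χ i x 0) • EuclideanSpace.single 0 1) + s • EuclideanSpace.single 0 1 ∈ O i) → (∀ x ∈ C, ∃ i, x ∈ W i ∧ |χ i x 0| < δ / 2) → ∃ (V : Fin N → Set ↥C) (f : Fin N → ↥C → EuclideanSpace ℝ (Fin 2)) (_ : ChartedSpace (EuclideanSpace ℝ (Fin 2)) ↥C) (_ : IsManifold (𝓡 2) ∞ ↥C), (∀ i, IsOpen (V i)) ∧ (∀ c : ↥C, ∃ i, c ∈ V i) ∧ (∀ i, ∀ c ∈ V i, c.1 ∈ W i ∧ |χ i c.1 0| < δ / 2) ∧ (∀ i, ∀ c ∈ V i, f i c 0 = χ i c.1 2 ∧ f i c 1 = χ i c.1 3) ∧ (∀ i, ContMDiffOn (𝓡 2) 𝓘(ℝ, EuclideanSpace ℝ (Fin 2)) ∞ (f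 i) (V i)) ∧ (∀ i, ∀ c ∈ V i, Function.Injective (mfderiv (𝓡 2) 𝓘(ℝ, EuclideanSpace ℝ (Fin 2)) (f i) c)) := by
  intro 𝓑 _ U K hU hK C hCH eC hinj hopen hatlas N δ W O χ χi hδ hch hroom hcov
  obtain ⟨e⟩ := eC
  haveI : T2Space ↥C := e.symm.t2Space
  have hCne : Nonempty ↥C :=
    ⟨e.symm (NormedSpace.sphere_nonempty.2 zero_le_one).to_subtype.some⟩
  set e0 : E4 := EuclideanSpace.single 0 1 with he0
  -- ## the linear algebra: the projection `P : ℝ⁴ → ℝ²` to the coordinates `2, 3` and the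
  -- transversal embedding `ι₀ : ℝ² → ℝ⁴`
  set P : E4 →L[ℝ] EuclideanSpace ℝ (Fin 2) :=
    (EuclideanSpace.proj (2 : Fin 4)).smulRight (EuclideanSpace.single (0 : Fin 2) (1 : ℝ)) +
      (EuclideanSpace.proj (3 : Fin 4)).smulRight (EuclideanSpace.single (1 : Fin 2) (1 : ℝ)) with hP
  have hP_apply : ∀ z : E4, P z =
      (z 2) • EuclideanSpace.single (0 : Fin 2) (1 : ℝ) + (z 3) • EuclideanSpace.single (1 : Fin 2) (1 : ℝ) :=
    fun z ↦ rfl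
  have hP0 : ∀ z : E4, P z 0 = z 2 := fun z ↦ by rw [hP_apply]; simp
  have hP1 : ∀ z : E4, P z 1 = z 3 := fun z ↦ by rw [hP_apply]; simp
  have hPe0 : P e0 = 0 := by
    ext k
    fin_cases k
    · simp [hP0, he0]
    · simp [hP1, he0]
  set ι0 : EuclideanSpace ℝ (Fin 2) →L[ℝ] E4 :=
    (EuclideanSpace.proj (0 : Fin 2)).smulRight (EuclideanSpace.single (2 : Fin 4) (1 : ℝ)) +
      (EuclideanSpace.proj (1 : Fin 2)).smulRight (EuclideanSpace.single (3 : Fin 4) (1 : ℝ)) with hι0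
  have hι0_apply : ∀ w : EuclideanSpace ℝ (Fin 2), ι0 w =
      (w 0) • EuclideanSpace.single (2 : Fin 4) (1 : ℝ) + (w 1) • EuclideanSpace.single (3 : Fin 4) (1 : ℝ) :=
    fun w ↦ rfl
  -- ## the leaf-chart domains `Vᵢ` and the leaf coordinates `fᵢ`
  obtain ⟨V, hV⟩ : ∃ V : Fin N → Set ↥C, ∀ i (c : ↥C), c ∈ V i ↔ c.1 ∈ W i ∧ |χ i c.1 0| < δ / 2 :=
    ⟨fun i ↦ {c | c.1 ∈ W i ∧ |χ i c.1 0| < δ / 2}, fun _ _ ↦ Iff.rfl⟩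
  obtain ⟨f, hf⟩ : ∃ f : Fin N → ↥C → EuclideanSpace ℝ (Fin 2), ∀ i, f i = fun c ↦ P (χ i c.1) :=
    ⟨fun i c ↦ P (χ i c.1), fun _ ↦ rfl⟩
  have hf0 : ∀ i (c : ↥C), f i c 0 = χ i c.1 2 := fun i c ↦ by rw [hf i, hP0]
  have hf1 : ∀ i (c : ↥C), f i c 1 = χ i c.1 3 := fun i c ↦ by rw [hf i, hP1]
  -- (1) the `Vᵢ` are open in `C`
  have hVo : ∀ i, IsOpen (V i) := by
    intro i
    obtain ⟨hWio, _, _, _, _, _, hχsi, _⟩ := hch i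
    have h1 : ContinuousOn (fun x ↦ |χ i x 0|) (W i) :=
      (continuous_abs.comp (EuclideanSpace.proj (0 : Fin 4)).continuous).comp_continuousOn
        hχsi.continuousOn
    have h2 : IsOpen (W i ∩ (fun x ↦ |χ i x 0|) ⁻¹' Iio (δ / 2)) :=
      h1.isOpen_inter_preimage hWio isOpen_Iio
    have h3 : V i = Subtype.val ⁻¹' (W i ∩ (fun x ↦ |χ i x 0|) ⁻¹' Iio (δ / 2)) :=
      Set.ext fun c ↦ hV i c
    rw [h3]
    exact h2.preimage continuous_subtype_val
  -- (2) they cover `C`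
  have hcovV : ∀ c : ↥C, ∃ i, c ∈ V i := by
    intro c
    obtain ⟨i, hW, hlt⟩ := hcov c.1 c.2
    exact ⟨i, (hV i c).2 ⟨hW, hlt⟩⟩
  -- (3) the `fᵢ` are continuous on `Vᵢ`
  have hfc : ∀ i, ContinuousOn (f i) (V i) := by
    intro i
    obtain ⟨_, _, _, _, _, _, hχsi, _⟩ := hch i
    rw [hf i]
    exact P.continuous.comp_continuousOn
      (hχsi.continuousOn.comp continuous_subtype_val.continuousOn fun c hc ↦ ((hV i c).1 hc).1)
  -- the `fᵢ` are injective on `Vᵢ`: two points of `Wᵢ ∩ C` on one chart line coincide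
  have hinjOn : ∀ i, InjOn (f i) (V i) := by
    intro i c hc c' hc' hcc'
    obtain ⟨hWio, hOi, hOci, hWiU, hinvi, hinvi', _, _, _, hhori, hlinei⟩ := hch i
    obtain ⟨hx, _⟩ := (hV i c).1 hc
    obtain ⟨hx', _⟩ := (hV i c').1 hc'
    have h2 : χ i c.1 2 = χ i c'.1 2 := by rw [← hf0, ← hf0, hcc']
    have h3 : χ i c.1 3 = χ i c'.1 3 := by rw [← hf1, ← hf1, hcc']
    have h1 : χ i c.1 1 = 0 := (hhori _ hx).1 (hCH c.2)
    have h1' : χ i c'.1 1 = 0 := (hhori _ hx').1 (hCH c'.2)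
    have hline : χ i c.1 = χ i c'.1 + (χ i c.1 0 - χ i c'.1 0) • e0 := by
      ext k
      fin_cases k
      · simp [he0]
      · simp [he0, h1, h1']
      · simp [he0, h2]
      · simp [he0, h3]
    exact Subtype.ext (hinj (W i) (O i) (χ i) (χi i) hWio hOi hOci hWiU hinvi hinvi' hhori hlinei
      c'.1 ⟨hx', c'.2⟩ c.1 ⟨hx, c.2⟩ _ hline)
  -- (4) the `fᵢ` are open on `Vᵢ` (invariance of domain)
  have hfo : ∀ i, ∀ V' ⊆ V i, IsOpen V' → IsOpen (f i '' V') :=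
    fun i ↦ hopen (V i) (f i) (hVo i) (hfc i) (hinjOn i)
  -- (5) the local inverses
  obtain ⟨fi, hfi⟩ : ∃ fi : Fin N → EuclideanSpace ℝ (Fin 2) → ↥C, ∀ i, ∀ c ∈ V i, fi i (f i c) = c := by
    classical
    obtain ⟨c₀⟩ := hCne
    refine ⟨fun i w ↦ if h : ∃ c ∈ V i, f i c = w then h.choose else c₀, fun i c hc ↦ ?_⟩
    have hex : ∃ c' ∈ V i, f i c' = f i c := ⟨c, hc, rfl⟩
    simp only [dif_pos hex]
    exact hinjOn i hex.choose_spec.1 hc hex.choose_spec.2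
  -- ## the geometry: chart lines, the base-point identity and the slice identity
  -- the chart line through a point of `Vᵢ` stays in `Oᵢ` for times in `Ioo (-δ) δ`
  have hseg : ∀ i (x : 𝓑.carrier), x ∈ W i → |χ i x 0| < δ / 2 →
      ∀ σ ∈ Ioo (-δ) δ, χ i x + σ • e0 ∈ O i := by
    intro i x hx hs σ hσ
    have h := hroom i x hx (by linarith [hs]) (χ i x 0 + σ)
      (by rw [abs_lt] at hs ⊢; constructor <;> linarith [hσ.1, hσ.2, hs.1, hs.2])
    have : χ i x - (χ i x 0) • e0 + (χ i x 0 + σ) • e0 = χ i x + σ • e0 := by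
      rw [add_smul]; abel
    rwa [this] at h
  -- the base-point identity `ι₀ (fᵢ c) = χᵢ c - (χᵢ c 0) • e₀` on `Vᵢ` (coordinate `1` vanishes on `𝓔⁺`)
  have hbase : ∀ i (c : ↥C), c ∈ V i → ι0 (f i c) = χ i c.1 - (χ i c.1 0) • e0 := by
    intro i c hc
    obtain ⟨_, _, _, _, _, _, _, _, _, hhori, _⟩ := hch i
    have hx : c.1 ∈ W i := ((hV i c).1 hc).1
    have h1 : χ i c.1 1 = 0 := (hhori _ hx).1 (hCH c.2)
    rw [hι0_apply, hf0, hf1]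
    ext k
    fin_cases k <;> simp [he0, h1]
  have hι0O : ∀ i (c : ↥C), c ∈ V i → ι0 (f i c) ∈ O i := by
    intro i c hc
    obtain ⟨hx, hs⟩ := (hV i c).1 hc
    rw [hbase i c hc]
    have h := hroom i c.1 hx (by linarith [hs]) 0 (by rw [abs_zero]; linarith)
    rwa [zero_smul, add_zero] at h
  -- the slice identity: for `c ∈ Vᵢ ∩ Vⱼ` the chart-`i` slice point lies in `Wⱼ`, with
  -- `χⱼ`-image `χⱼ c - (χᵢ c 0) • e₀` (the common chart line of the two charts through `c`)
  have hslice : ∀ i j (c : ↥C), c ∈ V i → c ∈ V j →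
      χi i (χ i c.1 - (χ i c.1 0) • e0) ∈ W j ∧
        χ j (χi i (χ i c.1 - (χ i c.1 0) • e0)) = χ j c.1 - (χ i c.1 0) • e0 := by
    intro i j c hci hcj
    obtain ⟨hxi, hsi⟩ := (hV i c).1 hci
    obtain ⟨hxj, hsj⟩ := (hV j c).1 hcj
    obtain ⟨_, _, _, hWiU, hinvi, hinvi', _, _, _, _, hlinei⟩ := hch i
    obtain ⟨_, _, _, hWjU, hinvj, hinvj', _, _, _, _, hlinej⟩ := hch j
    have hcoin := hK.eqOn_of_isMIntegralCurveOn hU isOpen_Ioo ordConnected_Ioo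
      (show (0 : ℝ) ∈ Ioo (-δ) δ from ⟨by linarith, hδ⟩)
      (hlinei c.1 hxi (-δ) δ (hseg i c.1 hxi hsi)) (hlinej c.1 hxj (-δ) δ (hseg j c.1 hxj hsj))
      (fun σ hσ ↦ hWiU (hinvi' _ (hseg i c.1 hxi hsi σ hσ)).1)
      (fun σ hσ ↦ hWjU (hinvj' _ (hseg j c.1 hxj hsj σ hσ)).1)
      (by show χi i (χ i c.1 + (0 : ℝ) • e0) = χi j (χ j c.1 + (0 : ℝ) • e0)
          rw [zero_smul, add_zero, add_zero, (hinvi _ hxi).2, (hinvj _ hxj).2])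
    have hσmem : -(χ i c.1 0) ∈ Ioo (-δ) δ := by
      rw [abs_lt] at hsi; constructor <;> linarith [hsi.1, hsi.2]
    have hpt := hcoin hσmem
    simp only at hpt
    have hrw : χ i c.1 - (χ i c.1 0) • e0 = χ i c.1 + (-(χ i c.1 0)) • e0 := by
      rw [neg_smul, sub_eq_add_neg]
    rw [hrw, hpt]
    have hOmem := hseg j c.1 hxj hsj _ hσmem
    refine ⟨(hinvj' _ hOmem).1, ?_⟩
    rw [(hinvj' _ hOmem).2, neg_smul, sub_eq_add_neg]
  -- (6) the transition maps are smooth: `fⱼ ∘ fiᵢ` is the holonomy `w ↦ P (χⱼ (χiᵢ (ι₀ w)))`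
  have htrans : ∀ i j, ContDiffOn ℝ ∞ (f j ∘ fi i) (f i '' (V i ∩ V j)) := by
    intro i j
    obtain ⟨_, _, _, _, _, _, _, hχii, _⟩ := hch i
    obtain ⟨_, _, _, _, _, _, hχsj, _⟩ := hch j
    set Ω : Set (EuclideanSpace ℝ (Fin 2)) := {w | ι0 w ∈ O i ∧ χi i (ι0 w) ∈ W j} with hΩ
    have h1 : ContMDiffOn 𝓘(ℝ, EuclideanSpace ℝ (Fin 2)) (𝓡 4) ∞ (fun w ↦ χi i (ι0 w)) Ω :=
      hχii.comp ι0.contMDiff.contMDiffOn (fun w hw ↦ hw.1)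
    have h2 : ContMDiffOn 𝓘(ℝ, EuclideanSpace ℝ (Fin 2)) 𝓘(ℝ, E4) ∞
        (fun w ↦ χ j (χi i (ι0 w))) Ω :=
      hχsj.comp h1 (fun w hw ↦ hw.2)
    have h3 : ContMDiffOn 𝓘(ℝ, EuclideanSpace ℝ (Fin 2)) 𝓘(ℝ, EuclideanSpace ℝ (Fin 2)) ∞
        (fun w ↦ P (χ j (χi i (ι0 w)))) Ω :=
      P.contMDiff.comp_contMDiffOn h2
    have hF : ContDiffOn ℝ ∞ (fun w ↦ P (χ j (χi i (ι0 w)))) Ω := contMDiffOn_iff_contDiffOn.1 h3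
    have hsub : f i '' (V i ∩ V j) ⊆ Ω := by
      rintro _ ⟨c, ⟨hci, hcj⟩, rfl⟩
      show ι0 (f i c) ∈ O i ∧ χi i (ι0 (f i c)) ∈ W j
      refine ⟨hι0O i c hci, ?_⟩
      rw [hbase i c hci]
      exact (hslice i j c hci hcj).1
    refine (hF.mono hsub).congr ?_
    rintro _ ⟨c, ⟨hci, hcj⟩, rfl⟩
    show f j (fi i (f i c)) = P (χ j (χi i (ι0 (f i c))))
    rw [hfi i c hci, hbase i c hci, (hslice i j c hci hcj).2, map_sub, map_smul, hPe0, smul_zero,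
      sub_zero, hf j]
  -- ## the smooth structure and the conclusion
  obtain ⟨cs, hM, hfV, hfiV⟩ := hatlas ↥C N V f fi hVo hcovV hfc hfo hfi htrans
  letI : ChartedSpace (EuclideanSpace ℝ (Fin 2)) ↥C := cs
  haveI : IsManifold (𝓡 2) ∞ ↥C := hM
  refine ⟨V, f, cs, hM, hVo, hcovV, fun i c hc ↦ (hV i c).1 hc, fun i c _ ↦ ⟨hf0 i c, hf1 i c⟩,
    hfV, ?_⟩
  -- injective differential: `fiᵢ ∘ fᵢ = id` near `c`, so `d(fiᵢ) ∘ dfᵢ = id`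
  intro i c hc
  have hdf : MDifferentiableAt (𝓡 2) 𝓘(ℝ, EuclideanSpace ℝ (Fin 2)) (f i) c :=
    ((hfV i).contMDiffAt ((hVo i).mem_nhds hc)).mdifferentiableAt (by simp)
  have hdfi : MDifferentiableAt 𝓘(ℝ, EuclideanSpace ℝ (Fin 2)) (𝓡 2) (fi i) (f i c) :=
    ((hfiV i).contMDiffAt ((hfo i (V i) Subset.rfl (hVo i)).mem_nhds
      (mem_image_of_mem _ hc))).mdifferentiableAt (by simp)
  have hev : fi i ∘ f i =ᶠ[𝓝 c] id := by
    filter_upwards [(hVo i).mem_nhds hc] with c' hc' using hfi i c' hc'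
  have hid : (mfderiv 𝓘(ℝ, EuclideanSpace ℝ (Fin 2)) (𝓡 2) (fi i) (f i c)).comp
      (mfderiv (𝓡 2) 𝓘(ℝ, EuclideanSpace ℝ (Fin 2)) (f i) c) =
        ContinuousLinearMap.id ℝ (TangentSpace (𝓡 2) c) := by
    rw [← mfderiv_comp c hdfi hdf, hev.mfderiv_eq, mfderiv_id]
  intro v₁ v₂ hv
  have h := congrArg (mfderiv 𝓘(ℝ, EuclideanSpace ℝ (Fin 2)) (𝓡 2) (fi i) (f i c)) hv
  rw [← ContinuousLinearMap.comp_apply, ← ContinuousLinearMap.comp_apply, hid] at h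
  exact h

end Summit.FinalStateConjecture.FinalStateConjecture.Theorems.HawkingExtensionIsKerr.SketchIdeator2

end
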